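/-
COR-CM (cell pub-hodgecm2, stage 2 of the Hodge ladder) — count-neutral KERNEL COMBINATORICS «index-two descent of abstract CM types: the bi-marginal-zero lattice is
a ℤ[G]-module» (seat prover-pub-hodgecm2-b23-g41-0, binder prover b23, gen 41; claim QUARTIC-TRANSPORT, CLAIM-ADDENDUM #1 «INDEX-TWO DESCENT», HOME/INBOX.md l.10136;
blanket `Census/IndexTwoDescent*` l.10149).
Theorems only, on top of parts I/II/IV (`Census/IndexTwoDescent{Dictionary,Hodge,Mixed}.lean`), `Census/BlockParityHodgeFamilies.lean` (`mapDomain_rt_gface`) and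
`Census/BlockParityRelations.lean` (`oflipCM_oflipCM_comm`) BY NAME; no `decide`, no certificate, no named fact, no `sorry`; `Interfaces.lean` (C1), every E term, B01,
`Transposition/*`, `PortJoin/*` untouched.
HONEST FRAMING: `HC_CM` is NOT proved, here or anywhere in the tree; nothing here is a period, a count of record or a headline.
T5: n/a-class (hypothesis binders: `c ∈ H`, `c * c = 1`, `c` central, `x ∉ H`, `H.index = 2`); checker: self, 2026-08-23.
-/
import Summits.HodgeConjecture.CorCM.Census.IndexTwoDescentMixed
import Summits.HodgeConjecture.CorCM.Census.BlockParityRelations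

/-!
# Index-two descent of abstract CM types, V: base change preserves the coordinate / mixed classification; `Z` is a `ℤ[G]`-module

Along an index-two subgroup `H ∋ c` (`c` central, `x ∉ H`): base change along `h ∈ H` commutes with both marginals (`marg₀_mapDomain_rt_coe`,
`marg₁_mapDomain_rt_coe`); base change along ANY `Q ∈ G` carries mixed faces to mixed faces (`mapDomain_rt_mem_mixedSet`: the two places stay in opposite
cosets, swapping which is which when `Q ∉ H`; `gface_comm`), hence the span of the mixed faces — by part IV the bi-marginal-zero lattice
`Z = ker marg₀ ⊓ ker marg₁` — is stable under every base change (`mapDomain_rt_mem_span_mixed`, `mapDomain_rt_mem_ker_inf_ker`): `Z` is a `ℤ[G]`-submodule of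
`hodgeSpan (G, c)`, the object whose ORBIT-efficient generation is step (3) of seat b09's octic road map.

## References
* [Pohlmann1968] H. Pohlmann, Algebraic cycles on abelian varieties of complex multiplication type, Ann. of Math. 88 (1968), Thm 1.
-/

namespace Summit.HodgeConjecture.CorCM.Census.IndexTwoDescent

open Finset
open Summit.HodgeConjecture.CorCM.Prior.AllgGroup.RfwfAllgGroup
open Summit.HodgeConjecture.CorCM.Census.BlockParity

noncomputable section

variable {G : Type*} [Group G] [Fintype G] [DecidableEq G] {c : G}
variable {H : Subgroup G} [DecidablePred (· ∈ H)]

/-! ## §1 Base change along `H` commutes with the marginals -/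

/-- **`marg₀ (y·h⁻¹) = (marg₀ y)·h⁻¹`** for `h ∈ H`. [folklore] -/
theorem marg₀_mapDomain_rt_coe (hcH : c ∈ H) (h : H) (y : CMF G c →₀ ℤ) :
    marg₀ hcH (Finsupp.mapDomain (rt c (h : G)) y) = Finsupp.mapDomain (rt (⟨c, hcH⟩ : H) h) (marg₀ hcH y) := by
  induction y using Finsupp.induction_linear with
  | zero => simp
  | add y z hy hz => rw [Finsupp.mapDomain_add, map_add, map_add, Finsupp.mapDomain_add, hy, hz]
  | single Ψ n => rw [Finsupp.mapDomain_single, marg₀_single, marg₀_single, Finsupp.mapDomain_single, res₀_rt_coe]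

/-- **`marg₁ (y·h⁻¹) = (marg₁ y)·h⁻¹`** for `h ∈ H`. [folklore] -/
theorem marg₁_mapDomain_rt_coe (hcH : c ∈ H) (hcen : ∀ g : G, g * c = c * g) (x : G) (h : H) (y : CMF G c →₀ ℤ) :
    marg₁ hcH hcen x (Finsupp.mapDomain (rt c (h : G)) y) = Finsupp.mapDomain (rt (⟨c, hcH⟩ : H) h) (marg₁ hcH hcen x y) := by
  induction y using Finsupp.induction_linear with
  | zero => simp
  | add y z hy hz => rw [Finsupp.mapDomain_add, map_add, map_add, Finsupp.mapDomain_add, hy, hz]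
  | single Ψ n => rw [Finsupp.mapDomain_single, marg₁_single, marg₁_single, Finsupp.mapDomain_single, res₁_rt_coe]

/-! ## §2 Base change carries mixed faces to mixed faces -/

omit [DecidablePred (· ∈ H)] in
/-- **Faces are symmetric in their two places.** [folklore] -/
theorem gface_comm (hc2 : c * c = 1) (Φ : CMF G c) (t t' : G) : gface c hc2 Φ t t' = gface c hc2 Φ t' t := by
  unfold gface
  rw [oflipCM_oflipCM_comm c hc2 t t']
  abel

omit [DecidablePred (· ∈ H)] in
/-- **Base change carries mixed faces to mixed faces**: for every `Q ∈ G`, `(gface Ψ t (x t'))·Q⁻¹` again has one place in `H` and one in `xH`. [folklore] -/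
theorem mapDomain_rt_mem_mixedSet (hc2 : c * c = 1) (hH : H.index = 2) {x : G} (hx : x ∉ H) (Q : G) {y : CMF G c →₀ ℤ}
    (hy : y ∈ mixedSet c hc2 H x) : Finsupp.mapDomain (rt c Q) y ∈ mixedSet c hc2 H x := by
  obtain ⟨Ψ, t, t', rfl⟩ := hy
  rw [mapDomain_rt_gface]
  by_cases hQ : Q ∈ H
  · -- both places stay in their cosets
    have h1 : (t : G) * Q⁻¹ ∈ H := H.mul_mem t.2 (H.inv_mem hQ)
    have h2 : x * (t' : G) * Q⁻¹ ∉ H := by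
      rw [mul_assoc, mul_mem_iff_not_mem hH hx]
      exact fun hn => hn (H.mul_mem t'.2 (H.inv_mem hQ))
    obtain ⟨s', hs'⟩ := exists_eq_mul_of_not_mem hH hx h2
    refine ⟨rt c Q Ψ, ⟨(t : G) * Q⁻¹, h1⟩, s', ?_⟩
    rw [← hs']
  · -- the places swap cosets
    have hQi : Q⁻¹ ∉ H := fun hn => hQ (by simpa using H.inv_mem hn)
    have h1 : (t : G) * Q⁻¹ ∉ H := by
      rw [Subgroup.mul_mem_iff_of_index_two hH]
      exact fun hn => hQi (hn.mp t.2)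
    have h2 : x * (t' : G) * Q⁻¹ ∈ H := by
      rw [mul_assoc, Subgroup.mul_mem_iff_of_index_two hH]
      constructor
      · exact fun hxH => absurd hxH hx
      · intro hn
        rw [Subgroup.mul_mem_iff_of_index_two hH] at hn
        exact absurd (hn.mp t'.2) hQi
    obtain ⟨s, hs⟩ := exists_eq_mul_of_not_mem hH hx h1
    refine ⟨rt c Q Ψ, ⟨x * (t' : G) * Q⁻¹, h2⟩, s, ?_⟩
    rw [gface_comm, ← hs]

omit [DecidablePred (· ∈ H)] in
/-- **The span of the mixed faces is base-change stable.** [folklore] -/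
theorem mapDomain_rt_mem_span_mixed (hc2 : c * c = 1) (hH : H.index = 2) {x : G} (hx : x ∉ H) (Q : G) {y : CMF G c →₀ ℤ}
    (hy : y ∈ Submodule.span ℤ (mixedSet c hc2 H x)) : Finsupp.mapDomain (rt c Q) y ∈ Submodule.span ℤ (mixedSet c hc2 H x) := by
  have hmap : Submodule.map (Finsupp.lmapDomain ℤ ℤ (rt c Q)) (Submodule.span ℤ (mixedSet c hc2 H x)) ≤ Submodule.span ℤ (mixedSet c hc2 H x) := by
    rw [Submodule.map_span, Submodule.span_le]
    rintro _ ⟨z, hz, rfl⟩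
    exact Submodule.subset_span (by rw [Finsupp.lmapDomain_apply]; exact mapDomain_rt_mem_mixedSet hc2 hH hx Q hz)
  have h := hmap (Submodule.mem_map_of_mem (f := Finsupp.lmapDomain ℤ ℤ (rt c Q)) hy)
  rwa [Finsupp.lmapDomain_apply] at h

/-- **THE BI-MARGINAL-ZERO LATTICE IS A `ℤ[G]`-MODULE**: `marg₀ y = marg₁ y = 0 ⟹ marg₀ (y·Q⁻¹) = marg₁ (y·Q⁻¹) = 0` for every `Q ∈ G`. [folklore] -/
theorem mapDomain_rt_mem_ker_inf_ker (hcH : c ∈ H) (hcen : ∀ g : G, g * c = c * g) (hc2 : c * c = 1) (hH : H.index = 2) {x : G} (hx : x ∉ H)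
    (Ψ₀ : CMF G c) (Q : G) {y : CMF G c →₀ ℤ} (hy : y ∈ LinearMap.ker (marg₀ hcH) ⊓ LinearMap.ker (marg₁ hcH hcen x)) :
    Finsupp.mapDomain (rt c Q) y ∈ LinearMap.ker (marg₀ hcH) ⊓ LinearMap.ker (marg₁ hcH hcen x) := by
  rw [← span_mixed_eq hcH hcen hc2 hH hx Ψ₀] at hy ⊢
  exact mapDomain_rt_mem_span_mixed hc2 hH hx Q hy

/-- Translates of a family of bi-marginal-zero vectors stay bi-marginal-zero: `ℤ⟨translates S⟩ ≤ Z` for `S ⊆ Z`. [folklore] -/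
theorem span_translates_le_ker_inf_ker (hcH : c ∈ H) (hcen : ∀ g : G, g * c = c * g) (hc2 : c * c = 1) (hH : H.index = 2) {x : G} (hx : x ∉ H)
    (Ψ₀ : CMF G c) (S : Finset (CMF G c →₀ ℤ))
    (hS : (S : Set (CMF G c →₀ ℤ)) ⊆ ↑(LinearMap.ker (marg₀ hcH) ⊓ LinearMap.ker (marg₁ hcH hcen x))) :
    Submodule.span ℤ (translates c S) ≤ LinearMap.ker (marg₀ hcH) ⊓ LinearMap.ker (marg₁ hcH hcen x) := by
  rw [Submodule.span_le]
  rintro _ ⟨Q, s, hs, rfl⟩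
  exact mapDomain_rt_mem_ker_inf_ker hcH hcen hc2 hH hx Ψ₀ Q (hS (Finset.mem_coe.mpr hs))

end

end Summit.HodgeConjecture.CorCM.Census.IndexTwoDescent
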